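import Summits.ValiantsHypothesis.ValiantsHypothesis.Theorems.CirculantFourierHrubesBridgeGates
import Literature.Computability.AlgebraicComplexity.DeterminantalIdealComplexityDescent
import HarnessLib

/-!
# Route TameSensitivity — quantitative Hrubeš simulation, part A: the bounded representation

Support file 1/3 for item `QuantHrubesPer` (stmt-ValiantsHypothesis-23473 of route
`TameSensitivity`; verbatim also stmt-ValiantsHypothesis-23515 of route `DecompCycle1`), proved in
`Theorems/TameSensitivityQuantHrubes.lean`.

We re-run the one-pass simulation of `Theorems/CirculantFourierHrubesBridgeRep.lean` (route
`CirculantFourier`; its part A `CirculantFourierHrubesBridgeGates` — availability bookkeeping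
for plain fan-in-two gate lists over `ℝ≥0` — is imported and used as is) with ONE extra conjunct
in the invariant (local notation `RepB[gs, d, w, wt]`): the constants `c_k` of the representation
`P_k - Q_k = w^{(k)}`, `P_k + Q_k = c_k L^k` (`L = Σ_i x_i`) of a gate value `w` of the simulated
real circuit are bounded by the all-ones evaluation of the degree-`k` part of the corresponding
gate value `wt` of the ABS-VALUE TWIN circuit over `ℝ≥0` (constants replaced by `Real.nnabs`):
`c_k ≤ wt^{(k)}(1,…,1)`. This is what makes Hrubeš's threshold `ε₀ = 1/R` explicit
(`R ≤ |P|(1,…,1)`), as the route's crux B2 requires.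

Contents: all-ones evaluations of homogeneous components over `ℝ≥0`; the change of constants
`|·| = ι ∘ nnabs` on circuits; index bookkeeping; the representation for `0`, constants, sums and
real scalar multiples (Hrubeš 2020, Lemma 22 eq. (4), Lemma 23). Products, variables and the gate
induction are in part B (`TameSensitivityQuantHrubesRep`).

Honest framing: bookkeeping for a provable-now SUPPORT item of two open routes; nothing here
bears on VP ≠ VNP itself.

## References

* [Hrubes2020] P. Hrubeš, *On ε-sensitive monotone computations*, Comput. Complexity 29 (2020)
  Art. 6 (ECCC TR19-034), §4: Lemma 22, Lemma 23, Theorem 1.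
* [JerrumSnir1982] M. Jerrum, M. Snir, J. ACM 29 (1982), §2.2 (the monotone model).
* [Burgisser2000] P. Bürgisser, *Completeness and Reduction in Algebraic Complexity Theory*,
  Def. 2.1, §4.1 (circuits, change of constants).
-/

noncomputable section

-- `Summit.ValiantsHypothesis.ValiantsHypothesis.…` is the tree's mandated layout (Sub = Summit).
set_option linter.dupNamespace false

namespace Summit.ValiantsHypothesis.ValiantsHypothesis.Theorems.TameSensitivityQuantHrubes

open MvPolynomial Literature.Computability.AlgebraicComplexity ArithCircuit
  Literature.Barriers.ValiantsHypothesis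
open Summit.ValiantsHypothesis.ValiantsHypothesis.Theorems.CirculantFourierHrubes
open scoped NNReal

variable {σ : Type*}

/-- `Good[gs]` (local notation, not a definition): every gate of `gs` has fan-in `≤ 2` and is
plain. -/
local notation3 (prettyPrint := false) "Good[" gs "]" =>
  ∀ g ∈ (gs : List (Gate ℝ≥0 _)), Gate.fanIn g ≤ 2 ∧ IsPlainGate g

/-- `Av[gs, a]` (local notation, not a definition): some operand referring only to gates of `gs`
evaluates to `a` against the values of `gs`. -/
local notation3 (prettyPrint := false) "Av[" gs ", " a "]" =>
  ∃ u : Operand ℝ≥0 _, Operand.RefsBelow (List.length gs) u ∧ Operand.eval (gateValues gs) u = a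

/-- `RepB[gs, d, w, wt]` (local notation, not a definition): the real polynomial `w` is
*represented with bound `wt`* after the gates `gs` up to degree `d` — for every `k ≤ d` there are
available `P_k, Q_k ∈ ℝ≥0[x]` and `c_k ≥ 0` with `P_k - Q_k = w^{(k)}`, `P_k + Q_k = c_k L^k`
(`L = Σ_i x_i`) and `c_k ≤ wt^{(k)}(1,…,1)` (`wt ∈ ℝ≥0[x]`, the abs-value twin of `w`). -/
local notation3 (prettyPrint := false) "RepB[" gs ", " d ", " w ", " wt "]" =>
  ∃ (P Q : ℕ → MvPolynomial _ ℝ≥0) (c : ℕ → ℝ≥0), ∀ k ≤ (d : ℕ),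
    Av[gs, P k] ∧ Av[gs, Q k] ∧
    MvPolynomial.map NNReal.toRealHom (P k) - MvPolynomial.map NNReal.toRealHom (Q k) =
      MvPolynomial.homogeneousComponent k w ∧
    P k + Q k = c k • (∑ i, MvPolynomial.X i) ^ k ∧
    c k ≤ MvPolynomial.eval (fun _ => (1 : ℝ≥0)) (MvPolynomial.homogeneousComponent k wt)

/-! ### All-ones evaluations of homogeneous components over `ℝ≥0` -/

section EvalOne

/-- `(C a)^{(k)}(1) = a` if `k = 0`, else `0`. -/
theorem ev_hc_C (k : ℕ) (a : ℝ≥0) :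
    MvPolynomial.eval (fun _ => (1 : ℝ≥0)) (homogeneousComponent k (C a : MvPolynomial σ ℝ≥0)) =
      if k = 0 then a else 0 := by
  rw [homogeneousComponent_of_mem (isHomogeneous_C σ a)]
  split_ifs <;> simp

/-- `(X j)^{(k)}(1) = 1` if `k = 1`, else `0`. -/
theorem ev_hc_X (k : ℕ) (j : σ) :
    MvPolynomial.eval (fun _ => (1 : ℝ≥0)) (homogeneousComponent k (X j : MvPolynomial σ ℝ≥0)) =
      if k = 1 then 1 else 0 := by
  rw [homogeneousComponent_of_mem (isHomogeneous_X ℝ≥0 j)]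
  split_ifs <;> simp

/-- Additivity of `p ↦ p^{(k)}(1)`. -/
theorem ev_hc_add (k : ℕ) (p q : MvPolynomial σ ℝ≥0) :
    MvPolynomial.eval (fun _ => (1 : ℝ≥0)) (homogeneousComponent k (p + q)) =
      MvPolynomial.eval (fun _ => (1 : ℝ≥0)) (homogeneousComponent k p) +
        MvPolynomial.eval (fun _ => (1 : ℝ≥0)) (homogeneousComponent k q) := by
  rw [map_add, map_add]

/-- Homogeneity of `p ↦ p^{(k)}(1)` under scalars. -/
theorem ev_hc_smul (k : ℕ) (a : ℝ≥0) (p : MvPolynomial σ ℝ≥0) :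
    MvPolynomial.eval (fun _ => (1 : ℝ≥0)) (homogeneousComponent k (a • p)) =
      a * MvPolynomial.eval (fun _ => (1 : ℝ≥0)) (homogeneousComponent k p) := by
  rw [LinearMap.map_smul, smul_eval]

/-- Product rule: `(p q)^{(k)}(1) = Σ_{a ≤ k} p^{(a)}(1) q^{(k-a)}(1)`. -/
theorem ev_hc_mul (k : ℕ) (p q : MvPolynomial σ ℝ≥0) :
    MvPolynomial.eval (fun _ => (1 : ℝ≥0)) (homogeneousComponent k (p * q)) =
      ∑ a ∈ Finset.range (k + 1),
        MvPolynomial.eval (fun _ => (1 : ℝ≥0)) (homogeneousComponent a p) *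
          MvPolynomial.eval (fun _ => (1 : ℝ≥0)) (homogeneousComponent (k - a) q) := by
  rw [homogeneousComponent_mul_eq_sum, map_sum]
  simp only [map_mul]

/-- Over `ℝ≥0`, `p^{(k)}(1) ≤ p(1)`. -/
theorem ev_hc_le (k : ℕ) (p : MvPolynomial σ ℝ≥0) :
    MvPolynomial.eval (fun _ => (1 : ℝ≥0)) (homogeneousComponent k p) ≤
      MvPolynomial.eval (fun _ => (1 : ℝ≥0)) p := by
  have hp : ∑ i ∈ Finset.range (p.totalDegree + k + 1), homogeneousComponent i p = p :=
    sum_homogeneousComponent_of_lt p (by omega)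
  conv_rhs => rw [← hp, map_sum]
  exact Finset.single_le_sum
    (f := fun i => MvPolynomial.eval (fun _ => (1 : ℝ≥0)) (homogeneousComponent i p))
    (fun _ _ => _root_.zero_le) (Finset.mem_range.mpr (by omega))

/-- `γ₊ + γ₋ = |γ|` in `ℝ≥0`. -/
theorem toNNReal_add_toNNReal_neg (γ : ℝ) :
    Real.toNNReal γ + Real.toNNReal (-γ) = Real.nnabs γ := by
  apply NNReal.eq
  rw [NNReal.coe_add, Real.coe_toNNReal', Real.coe_toNNReal', Real.coe_nnabs,
    max_zero_add_max_neg_zero_eq_abs_self]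

/-- `↑(q(1)) = (ι q)(1)` for the inclusion `ι : ℝ≥0 → ℝ`. -/
theorem coe_eval_one (q : MvPolynomial σ ℝ≥0) :
    ((MvPolynomial.eval (fun _ => (1 : ℝ≥0)) q : ℝ≥0) : ℝ) =
      MvPolynomial.eval (fun _ => (1 : ℝ)) (MvPolynomial.map NNReal.toRealHom q) := by
  induction q using MvPolynomial.induction_on with
  | C a => simp
  | add p q hp hq => simp [hp, hq]
  | mul_X p i hp => simp [hp]

end EvalOne

/-! ### The abs-value twin: change of constants along `|·| = ι ∘ nnabs` -/

section Twin

/-- Composition of changes of constants, operands. -/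
theorem operand_map_map {k k' k'' : Type*} (φ : k → k') (ψ : k' → k'') (u : Operand k σ) :
    (u.map φ).map ψ = u.map (ψ ∘ φ) := by
  cases u <;> rfl

/-- Composition of changes of constants, gates. -/
theorem gate_map_map {k k' k'' : Type*} (φ : k → k') (ψ : k' → k'') (g : Gate k σ) :
    (g.map φ).map ψ = g.map (ψ ∘ φ) := by
  cases g <;> simp [Gate.map, List.map_map, Function.comp_def, operand_map_map]

/-- The abs-value twin over `ℝ` is the change of scalars along `ι : ℝ≥0 → ℝ` of the twin over
`ℝ≥0`. -/
theorem map_mapConsts_nnabs (P₀ : ArithCircuit ℝ σ) :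
    (P₀.mapConsts Real.nnabs).map NNReal.toRealHom = P₀.mapConsts (fun c : ℝ => |c|) := by
  have hc : ((NNReal.toRealHom : ℝ≥0 → ℝ) ∘ (Real.nnabs : ℝ → ℝ≥0)) = fun c : ℝ => |c| := by
    funext c
    simp
  obtain ⟨gates, output⟩ := P₀
  simp only [ArithCircuit.map, ArithCircuit.mapConsts, List.map_map, ArithCircuit.mk.injEq]
  refine ⟨List.map_congr_left fun g _ => ?_, ?_⟩
  · rw [Function.comp_apply, gate_map_map, hc]
  · rw [operand_map_map, hc]

/-- The all-ones value of the `ℝ≥0`-twin is the all-ones value of the abs-value twin. -/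
theorem coe_eval_one_twin (P₀ : ArithCircuit ℝ σ) :
    ((MvPolynomial.eval (fun _ => (1 : ℝ≥0)) (P₀.mapConsts Real.nnabs).eval : ℝ≥0) : ℝ) =
      MvPolynomial.eval (fun _ => (1 : ℝ)) (P₀.mapConsts (fun c : ℝ => |c|)).eval := by
  rw [coe_eval_one, ← eval_map_apply, map_mapConsts_nnabs]

end Twin

/-! ### Index bookkeeping for value lists -/

section GetD

/-- In-range references survive appending one value. -/
theorem getD_concat_of_lt {α : Type*} (l : List α) (x d : α) {j : ℕ} (hj : j < l.length) :
    (l ++ [x]).getD j d = l.getD j d := by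
  rw [List.getD_eq_getElem?_getD, List.getElem?_append_left hj, ← List.getD_eq_getElem?_getD]

/-- Out-of-range references read the default. -/
theorem getD_concat_of_gt {α : Type*} (l : List α) (x d : α) {j : ℕ} (hj : l.length < j) :
    (l ++ [x]).getD j d = d := by
  rw [List.getD_eq_getElem?_getD, List.getElem?_eq_none (by simp; omega)]
  rfl

end GetD

/-! ### The bounded representation (Hrubeš 2020, Lemmas 22–23, with the twin bound) -/

section Rep

variable [Fintype σ]

/-- Representation is stable under appending gates. -/
theorem repB_mono {gs : List (Gate ℝ≥0 σ)} (gs' : List (Gate ℝ≥0 σ)) {d : ℕ}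
    {w : MvPolynomial σ ℝ} {wt : MvPolynomial σ ℝ≥0} (h : RepB[gs, d, w, wt]) :
    RepB[gs ++ gs', d, w, wt] := by
  obtain ⟨P, Q, c, h⟩ := h
  refine ⟨P, Q, c, fun k hk => ?_⟩
  obtain ⟨h1, h2, h3, h4, h5⟩ := h k hk
  exact ⟨av_mono gs' h1, av_mono gs' h2, h3, h4, h5⟩

/-- `0` is represented, with any twin. -/
theorem repB_zero (gs : List (Gate ℝ≥0 σ)) (d : ℕ) (wt : MvPolynomial σ ℝ≥0) :
    RepB[gs, d, (0 : MvPolynomial σ ℝ), wt] :=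
  ⟨fun _ => 0, fun _ => 0, fun _ => 0, fun k _ =>
    ⟨av_zero gs, av_zero gs, by simp, by simp, _root_.zero_le⟩⟩

/-- Constants are represented (positive and negative parts), twin `C |γ|`
(Hrubeš 2020, Lemma 22: `R_u = u` for a constant `u`). -/
theorem repB_C (gs : List (Gate ℝ≥0 σ)) (d : ℕ) (γ : ℝ) :
    RepB[gs, d, (C γ : MvPolynomial σ ℝ), (C (Real.nnabs γ) : MvPolynomial σ ℝ≥0)] := by
  refine ⟨fun k => if k = 0 then C (Real.toNNReal γ) else 0,
    fun k => if k = 0 then C (Real.toNNReal (-γ)) else 0,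
    fun k => if k = 0 then Real.toNNReal γ + Real.toNNReal (-γ) else 0, fun k _ => ?_⟩
  have hC : homogeneousComponent k (C γ : MvPolynomial σ ℝ) = if k = 0 then C γ else 0 :=
    homogeneousComponent_of_mem (isHomogeneous_C σ γ)
  by_cases hk : k = 0
  · subst hk
    simp only [↓reduceIte]
    refine ⟨av_C gs _, av_C gs _, ?_, ?_, ?_⟩
    · rw [hC, if_pos rfl, map_C, map_C, ← C_sub]
      congr 1
      simp [Real.coe_toNNReal']
    · rw [pow_zero, ← C_add, C_eq_smul_one]
    · rw [ev_hc_C, if_pos rfl, toNNReal_add_toNNReal_neg]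
  · simp only [hk, ↓reduceIte]
    refine ⟨av_zero gs, av_zero gs, ?_, by simp, _root_.zero_le⟩
    rw [hC, if_neg hk]; simp

/-- Sums of represented polynomials are represented after `≤ 2 (d + 1)` new gates; twins add
(Hrubeš 2020, Lemma 22 eq. (4)). -/
theorem repB_add {gs : List (Gate ℝ≥0 σ)} (hgs : Good[gs]) (d : ℕ) {w₁ w₂ : MvPolynomial σ ℝ}
    {wt₁ wt₂ : MvPolynomial σ ℝ≥0}
    (h₁ : RepB[gs, d, w₁, wt₁]) (h₂ : RepB[gs, d, w₂, wt₂]) :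
    ∃ gs' : List (Gate ℝ≥0 σ), Good[gs ++ gs'] ∧ gs'.length ≤ 2 * (d + 1) ∧
      RepB[gs ++ gs', d, w₁ + w₂, wt₁ + wt₂] := by
  obtain ⟨P₁, Q₁, c₁, h₁⟩ := h₁
  obtain ⟨P₂, Q₂, c₂, h₂⟩ := h₂
  have hAmono : ∀ gs gs' : List (Gate ℝ≥0 σ),
      (∀ k ≤ d, Av[gs, P₁ k] ∧ Av[gs, Q₁ k] ∧ Av[gs, P₂ k] ∧ Av[gs, Q₂ k]) →
      (∀ k ≤ d, Av[gs ++ gs', P₁ k] ∧ Av[gs ++ gs', Q₁ k] ∧ Av[gs ++ gs', P₂ k] ∧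
        Av[gs ++ gs', Q₂ k]) := fun gs gs' h k hk =>
    ⟨av_mono gs' (h k hk).1, av_mono gs' (h k hk).2.1, av_mono gs' (h k hk).2.2.1,
      av_mono gs' (h k hk).2.2.2⟩
  have hA : ∀ k ≤ d, Av[gs, P₁ k] ∧ Av[gs, Q₁ k] ∧ Av[gs, P₂ k] ∧ Av[gs, Q₂ k] :=
    fun k hk => ⟨(h₁ k hk).1, (h₁ k hk).2.1, (h₂ k hk).1, (h₂ k hk).2.1⟩
  obtain ⟨gs₁, hg₁, hl₁, hA₁, hs₁⟩ := ext_family hgs d 1 _ hAmono hA (fun k => P₁ k + P₂ k)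
    (fun gs' hg' hA' k hk => ext_add hg' (hA' k hk).1 (hA' k hk).2.2.1)
  obtain ⟨gs₂, hg₂, hl₂, -, hs₂⟩ := ext_family hg₁ d 1 _ hAmono hA₁ (fun k => Q₁ k + Q₂ k)
    (fun gs' hg' hA' k hk => ext_add hg' (hA' k hk).2.1 (hA' k hk).2.2.2)
  refine ⟨gs₁ ++ gs₂, by simpa only [List.append_assoc] using hg₂, ?_,
    fun k => P₁ k + P₂ k, fun k => Q₁ k + Q₂ k, fun k => c₁ k + c₂ k,
    fun k hk => ⟨?_, ?_, ?_, ?_, ?_⟩⟩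
  · rw [List.length_append]; omega
  · rw [← List.append_assoc]; exact av_mono gs₂ (hs₁ k hk)
  · rw [← List.append_assoc]; exact hs₂ k hk
  · obtain ⟨-, -, e₁, -, -⟩ := h₁ k hk
    obtain ⟨-, -, e₂, -, -⟩ := h₂ k hk
    rw [map_add, map_add, map_add, ← e₁, ← e₂]
    ring
  · obtain ⟨-, -, -, f₁, -⟩ := h₁ k hk
    obtain ⟨-, -, -, f₂, -⟩ := h₂ k hk
    rw [add_add_add_comm, f₁, f₂, add_smul]
  · obtain ⟨-, -, -, -, b₁⟩ := h₁ k hk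
    obtain ⟨-, -, -, -, b₂⟩ := h₂ k hk
    rw [ev_hc_add]
    exact add_le_add b₁ b₂

/-- Real scalar multiples of represented polynomials are represented after `≤ 6 (d + 1)` new
gates (a negative scalar swaps `P` and `Q`); the twin is scaled by `|γ|`
(Hrubeš 2020, Lemma 23: `c = c₊ - c₋`). -/
theorem repB_smul {gs : List (Gate ℝ≥0 σ)} (hgs : Good[gs]) (d : ℕ) (γ : ℝ)
    {w : MvPolynomial σ ℝ} {wt : MvPolynomial σ ℝ≥0} (h : RepB[gs, d, w, wt]) :
    ∃ gs' : List (Gate ℝ≥0 σ), Good[gs ++ gs'] ∧ gs'.length ≤ 6 * (d + 1) ∧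
      RepB[gs ++ gs', d, γ • w, Real.nnabs γ • wt] := by
  obtain ⟨P, Q, c, h⟩ := h
  have hAmono : ∀ gs gs' : List (Gate ℝ≥0 σ), (∀ k ≤ d, Av[gs, P k] ∧ Av[gs, Q k]) →
      (∀ k ≤ d, Av[gs ++ gs', P k] ∧ Av[gs ++ gs', Q k]) := fun gs gs' h k hk =>
    ⟨av_mono gs' (h k hk).1, av_mono gs' (h k hk).2⟩
  have hA : ∀ k ≤ d, Av[gs, P k] ∧ Av[gs, Q k] := fun k hk => ⟨(h k hk).1, (h k hk).2.1⟩
  obtain ⟨gs₁, hg₁, hl₁, hA₁, hs₁⟩ := ext_family hgs d 3 _ hAmono hA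
    (fun k => C (Real.toNNReal γ) * P k + C (Real.toNNReal (-γ)) * Q k)
    (fun gs' hg' hA' k hk => ext_mul_add hg' (av_C _ _) (hA' k hk).1 (av_C _ _) (hA' k hk).2)
  obtain ⟨gs₂, hg₂, hl₂, -, hs₂⟩ := ext_family hg₁ d 3 _ hAmono hA₁
    (fun k => C (Real.toNNReal γ) * Q k + C (Real.toNNReal (-γ)) * P k)
    (fun gs' hg' hA' k hk => ext_mul_add hg' (av_C _ _) (hA' k hk).2 (av_C _ _) (hA' k hk).1)
  have hγ : (C γ : MvPolynomial σ ℝ) = C (Real.toNNReal γ : ℝ) - C (Real.toNNReal (-γ) : ℝ) := by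
    rw [← C_sub, Real.coe_toNNReal', Real.coe_toNNReal', max_zero_sub_max_neg_zero_eq_self]
  refine ⟨gs₁ ++ gs₂, by simpa only [List.append_assoc] using hg₂, ?_,
    fun k => C (Real.toNNReal γ) * P k + C (Real.toNNReal (-γ)) * Q k,
    fun k => C (Real.toNNReal γ) * Q k + C (Real.toNNReal (-γ)) * P k,
    fun k => (Real.toNNReal γ + Real.toNNReal (-γ)) * c k, fun k hk => ⟨?_, ?_, ?_, ?_, ?_⟩⟩
  · rw [List.length_append]; omega
  · rw [← List.append_assoc]; exact av_mono gs₂ (hs₁ k hk)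
  · rw [← List.append_assoc]; exact hs₂ k hk
  · obtain ⟨-, -, e, -, -⟩ := h k hk
    rw [LinearMap.map_smul, ← e, smul_eq_C_mul, hγ]
    simp only [map_add, map_mul, map_C, NNReal.coe_toRealHom]
    ring
  · obtain ⟨-, -, -, f, -⟩ := h k hk
    calc C (Real.toNNReal γ) * P k + C (Real.toNNReal (-γ)) * Q k +
          (C (Real.toNNReal γ) * Q k + C (Real.toNNReal (-γ)) * P k)
        = (C (Real.toNNReal γ) + C (Real.toNNReal (-γ))) * (P k + Q k) := by ring
      _ = _ := by rw [f, ← C_add, smul_eq_C_mul, smul_eq_C_mul, ← mul_assoc, ← C_mul]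
  · obtain ⟨-, -, -, -, b⟩ := h k hk
    rw [toNNReal_add_toNNReal_neg, ev_hc_smul]
    exact mul_le_mul_of_nonneg_left b (_root_.zero_le)

end Rep

end Summit.ValiantsHypothesis.ValiantsHypothesis.Theorems.TameSensitivityQuantHrubes

end
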